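import Literature.NumberTheory.LFunctions.DirichletLFunctionInverseBound
import Literature.NumberTheory.LFunctions.ClassicalPsiErrorTerm
import Literature.NumberTheory.LFunctions.LogZetaClassicalRegionBounds

/-!
# Crux `SystemZeroRepulsion` (stmt-Parity-11291), line `smooth-rough-lattice-acquisition` (skeleton v3,
lead c2): stub C `stub_apLogL` — the branch of `log L(s, χ)` on a classical region

Class `linₐ` (`k = 1`, `f = aX + b`, `a ≥ 2`) of the crux runs every non-principal `χ` mod `q` through the
pole-free Riesz engine with `L(s, χ)^z := exp(z ℓ(s))`; this file supplies `ℓ`: for `χ ≠ χ₀` mod `q`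
there are `c > 0`, `C ≥ 0` (depending on `q`, `χ`) and `ℓ` holomorphic on `zfr c = {σ > 1 − c/log(|t|+4)}`
(`ClassicalPsiData.zfr`) with `‖ℓ(s)‖ ≤ log log(|t| + 4) + C` there and `ℓ(s) = Σ_p −Log(1 − χ(p)p^{−s})`
for `σ > 1`.  Proof (Montgomery–Vaughan, *Multiplicative Number Theory I*, Theorem 11.4 and the proof
of Theorem 6.7): (i) MV Theorem 11.4 (`DirichletZFR.exists_norm_logDeriv_sub_polar_le`) and `L ≠ 0` on
`σ ≥ 1` give `c > 0`, `A ≥ 0` with `L(s, χ) ≠ 0`, `‖L'/L(s, χ)‖ ≤ A log(|t| + 4)` on `zfr c` (a possible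
exceptional real zero `β < 1` stays at distance `≥ (1 − β)/2` from the region); (ii) `zfr c` is open and
star-convex about `2`, so `Complex.exists_continuousOn_eqOn_exp_comp` gives a continuous logarithm of
`L(·, χ)`, holomorphic by `differentiableOn_of_exp_eq`, normalised at `2` and equal to the Euler logarithm
on `σ > 1` (`eqOn_of_exp_eq_exp`, `DirichletCharacter.LSeries_eulerProduct_exp_log`); (iii) the bound:
`‖ℓ‖ ≤ log ζ(σ) ≤ log(σ/(σ−1)) ≤ log log(|t|+4) + log 2` for `σ ≥ σ₁ = 1 + 1/log(|t|+4)`, and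
`‖ℓ(s) − ℓ(σ₁ + it)‖ ≤ (σ₁ − σ) sup ‖L'/L‖ ≤ (1 + c)A` (mean value inequality).  Everything is PROVED.
-/

noncomputable section

namespace Summit.Parity.BatemanHorn.Cruxes.SystemZeroRepulsion.NearFar

open Complex Set Filter Topology Metric
open Literature.NumberTheory.LFunctions

/-! ### A `χ`-dependent zero-free region with `L'/L ≪_χ log(|t| + 4)` -/

/-- Conversion between the two normalisations of the region: if `c (log q + log 4) ≤ c₁ log 4`
(`c, log q ≥ 0`) then `c/ℒ ≤ c₁/(log q + ℒ)` for every `ℒ ≥ log 4`. [folklore] -/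
private theorem apLogL_width_le {c c₁ Lq ℒ : ℝ} (hc : 0 ≤ c) (hLq : 0 ≤ Lq) (h4 : Real.log 4 ≤ ℒ)
    (h : c * (Lq + Real.log 4) ≤ c₁ * Real.log 4) : c / ℒ ≤ c₁ / (Lq + ℒ) := by
  have hlog4 : 0 < Real.log 4 := Real.log_pos (by norm_num)
  have hℒ : 0 < ℒ := hlog4.trans_le h4
  rw [div_le_div_iff₀ hℒ (by linarith)]
  have key : c * (Lq + ℒ) * Real.log 4 ≤ c₁ * ℒ * Real.log 4 := by
    nlinarith [mul_le_mul_of_nonneg_left h hℒ.le, mul_le_mul_of_nonneg_left h4 (mul_nonneg hc hLq)]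
  exact le_of_mul_le_mul_right key hlog4

/-- **A `χ`-dependent classical region for `L(s, χ)`, `χ ≠ χ₀` mod `q`**: there are `c > 0` and `A ≥ 0`
(depending on `q` and `χ`) with `L(s, χ) ≠ 0` and `‖L'/L(s, χ)‖ ≤ A log(|t| + 4)` whenever
`σ > 1 − c/log(|t| + 4)`.  From MV Theorem 11.4 ((11.5)/(11.8)): if `χ` has an exceptional real zero
`β` then `β < 1` and `c ≤ (1 − β) log 4 / 2` keeps `|s − β| ≥ (1 − β)/2` on the region.
[cite: MontgomeryVaughan2007, Theorem 11.4] -/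
private theorem apLogL_logDeriv_bound (q : ℕ) [NeZero q] (χ : DirichletCharacter ℂ q) (hχ : χ ≠ 1) :
    ∃ c : ℝ, 0 < c ∧ ∃ A : ℝ, 0 ≤ A ∧ ∀ s : ℂ, 1 - c / Real.log (|s.im| + 4) < s.re →
      χ.LFunction s ≠ 0 ∧ ‖deriv χ.LFunction s / χ.LFunction s‖ ≤ A * Real.log (|s.im| + 4) := by
  obtain ⟨c₁, hc₁, -, C₁, hC₁, -, -, -, h4, h5⟩ := DirichletZFR.exists_norm_logDeriv_sub_polar_le
  have hLq : 0 ≤ Real.log q := Real.log_natCast_nonneg q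
  have hlog4 : 1 < Real.log 4 := ClassicalZFRData.one_lt_log_four
  have hL₀ : 0 < Real.log q + Real.log 4 := by linarith
  set c₀ : ℝ := c₁ * Real.log 4 / (Real.log q + Real.log 4) with hc₀
  have hc₀pos : 0 < c₀ := by positivity
  have hc₀key : c₀ * (Real.log q + Real.log 4) ≤ c₁ * Real.log 4 :=
    le_of_eq (by rw [hc₀, div_mul_cancel₀ _ hL₀.ne'])
  -- facts about `ℒ = log(|t| + 4)` used in both cases
  have hℒ4 : ∀ t : ℝ, Real.log 4 ≤ Real.log (|t| + 4) := fun t ↦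
    Real.log_le_log (by norm_num) (by linarith [abs_nonneg t])
  have hsum : ∀ t : ℝ, Real.log q + Real.log (|t| + 4) ≤ (1 + Real.log q) * Real.log (|t| + 4) :=
    fun t ↦ by nlinarith [ClassicalZFRData.one_le_log_tau t]
  by_cases hex : ∃ β : ℝ, χ.LFunction β = 0 ∧ 1 - 2 * c₁ / (Real.log q + Real.log 4) < β
  · -- the exceptional case: keep `β` at distance `≥ η/2`, `η = 1 − β > 0`
    obtain ⟨β, hβ, hβc⟩ := hex
    have hβ1 : β < 1 := by
      by_contra h
      exact DirichletCharacter.LFunction_ne_zero_of_one_le_re χ (Or.inl hχ) (by simpa using h) hβ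
    set η : ℝ := 1 - β with hη
    have hηpos : 0 < η := by simp only [hη]; linarith
    set c : ℝ := min c₀ (η * Real.log 4 / 2) with hcdef
    have hcpos : 0 < c := lt_min hc₀pos (by positivity)
    have hcc₀ : c ≤ c₀ := min_le_left _ _
    have hcη : c ≤ η * Real.log 4 / 2 := min_le_right _ _
    have hckey : c * (Real.log q + Real.log 4) ≤ c₁ * Real.log 4 :=
      (mul_le_mul_of_nonneg_right hcc₀ hL₀.le).trans hc₀key
    refine ⟨c, hcpos, C₁ * (1 + Real.log q) + 2 / η, by positivity, fun s hs ↦ ?_⟩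
    have hℒpos : 0 < Real.log (|s.im| + 4) := ClassicalZFRData.log_tau_pos _
    have hw := apLogL_width_le hcpos.le hLq (hℒ4 s.im) hckey
    have hreg : 1 - c₁ / (Real.log q + Real.log (|s.im| + 4)) ≤ s.re := by linarith
    have hcℒ : c / Real.log (|s.im| + 4) ≤ η / 2 := by
      rw [div_le_iff₀ hℒpos]
      calc c ≤ η * Real.log 4 / 2 := hcη
        _ ≤ η / 2 * Real.log (|s.im| + 4) := by nlinarith [hℒ4 s.im]
    have hdist : η / 2 < s.re - β := by simp only [hη] at hcℒ ⊢; linarith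
    have hsβ : s ≠ β := fun h ↦ by rw [h, ofReal_re] at hdist; linarith
    obtain ⟨hne, hb⟩ := h5 q χ hχ β hβ hβc s hreg hsβ
    refine ⟨hne, ?_⟩
    have hpol : ‖1 / (s - β)‖ ≤ 2 / η := by
      rw [norm_div, norm_one]
      have hre : s.re - β ≤ ‖s - (β : ℂ)‖ := by
        have := Complex.re_le_norm (s - β); simpa using this
      rw [div_le_div_iff₀ (by linarith) hηpos]
      nlinarith
    calc ‖deriv χ.LFunction s / χ.LFunction s‖
        = ‖(deriv χ.LFunction s / χ.LFunction s - 1 / (s - β)) + 1 / (s - β)‖ := by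
          rw [sub_add_cancel]
      _ ≤ ‖deriv χ.LFunction s / χ.LFunction s - 1 / (s - β)‖ + ‖1 / (s - β)‖ := norm_add_le _ _
      _ ≤ C₁ * (Real.log q + Real.log (|s.im| + 4)) + 2 / η := add_le_add hb hpol
      _ ≤ C₁ * ((1 + Real.log q) * Real.log (|s.im| + 4)) + 2 / η * Real.log (|s.im| + 4) :=
          add_le_add (mul_le_mul_of_nonneg_left (hsum s.im) hC₁)
            (le_mul_of_one_le_right (by positivity) (ClassicalZFRData.one_le_log_tau s.im))
      _ = (C₁ * (1 + Real.log q) + 2 / η) * Real.log (|s.im| + 4) := by ring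
  · -- no exceptional zero
    push Not at hex
    refine ⟨c₀, hc₀pos, C₁ * (1 + Real.log q), by positivity, fun s hs ↦ ?_⟩
    have hw := apLogL_width_le hc₀pos.le hLq (hℒ4 s.im) hc₀key
    have hreg : 1 - c₁ / (Real.log q + Real.log (|s.im| + 4)) ≤ s.re := by linarith
    obtain ⟨hne, hb⟩ := h4 q χ hχ hex s hreg
    refine ⟨hne, hb.trans ?_⟩
    calc C₁ * (Real.log q + Real.log (|s.im| + 4))
        ≤ C₁ * ((1 + Real.log q) * Real.log (|s.im| + 4)) :=
          mul_le_mul_of_nonneg_left (hsum s.im) hC₁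
      _ = C₁ * (1 + Real.log q) * Real.log (|s.im| + 4) := by ring

/-! ### The region `zfr c` is simply connected -/

/-- The region `zfr c = {σ > 1 − c/log(|t| + 4)}` (`c > 0`) is star-convex about `2`: its width
`c/log(|t| + 4)` decreases in `|t|`. [folklore] -/
private theorem apLogL_starConvex {c : ℝ} (hc : 0 < c) :
    StarConvex ℝ (2 : ℂ) (ClassicalPsiData.zfr c) := by
  -- adapted from `starConvex_zfrRegion` (Literature/NumberTheory/LFunctions/LogZetaClassicalRegion.lean)
  intro s hs a b ha hb hab
  rw [ClassicalPsiData.mem_zfr] at hs ⊢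
  have him : (a • (2 : ℂ) + b • s).im = b * s.im := by simp
  have hre : (a • (2 : ℂ) + b • s).re = 2 * a + b * s.re := by simp; ring
  rw [him, hre]
  have hb1 : b ≤ 1 := by linarith
  have hpos : 0 < c / Real.log (|s.im| + 4) := div_pos hc (ClassicalZFRData.log_tau_pos _)
  have hanti : c / Real.log (|s.im| + 4) ≤ c / Real.log (|b * s.im| + 4) := by
    apply div_le_div_of_nonneg_left hc.le (ClassicalZFRData.log_tau_pos _)
    apply Real.log_le_log (by positivity)
    have : |b * s.im| ≤ |s.im| := by
      rw [abs_mul, abs_of_nonneg hb]; exact mul_le_of_le_one_left (abs_nonneg _) hb1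
    linarith
  have hQ : b * (c / Real.log (|s.im| + 4)) ≤ c / Real.log (|b * s.im| + 4) :=
    (mul_le_of_le_one_left hpos.le hb1).trans hanti
  have key : 0 < a + (b * s.re - b + b * (c / Real.log (|s.im| + 4))) := by
    rcases hb.eq_or_lt with h | h
    · rw [← h] at hab ⊢
      simp only [add_zero] at hab
      rw [hab]; norm_num
    · have hX : 0 < s.re - 1 + c / Real.log (|s.im| + 4) := by linarith
      nlinarith [mul_pos h hX]
  linarith

/-- Hence `zfr c` (`c > 0`) is simply connected. [folklore] -/
private theorem apLogL_isSimplyConnected {c : ℝ} (hc : 0 < c) :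
    IsSimplyConnected (ClassicalPsiData.zfr c) := by
  have hne : (ClassicalPsiData.zfr c).Nonempty :=
    ⟨2, ClassicalPsiData.mem_zfr_of_one_le_re hc (by norm_num)⟩
  have := (apLogL_starConvex hc).contractibleSpace hne
  show SimplyConnectedSpace (ClassicalPsiData.zfr c)
  infer_instance

/-! ### The Euler logarithm `∑_p −Log(1 − χ(p)p^{−s})` on `σ > 1` -/

/-- `‖χ(p) p^{−s}‖ ≤ p^{−η}` for `Re s ≥ η`. [folklore] -/
private theorem apLogL_norm_term_le {q : ℕ} (χ : DirichletCharacter ℂ q) (p : Nat.Primes) {s : ℂ}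
    {η : ℝ} (hs : η ≤ s.re) :
    ‖χ ((p : ℕ) : ZMod q) * ((p : ℕ) : ℂ) ^ (-s)‖ ≤ ((p : ℕ) : ℝ) ^ (-η) := by
  rw [norm_mul]
  calc ‖χ ((p : ℕ) : ZMod q)‖ * ‖((p : ℕ) : ℂ) ^ (-s)‖ ≤ 1 * ((p : ℕ) : ℝ) ^ (-η) :=
        mul_le_mul (χ.norm_le_one _) (Nicolas.norm_primes_cpow_neg_le p hs) (norm_nonneg _)
          zero_le_one
    _ = ((p : ℕ) : ℝ) ^ (-η) := one_mul _

/-- The Euler logarithm `∑_p −Log(1 − χ(p)p^{−s})` of `L(s, χ)` is holomorphic on `Re s > 1` (locally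
uniform convergence: `‖Log(1 − χ(p)p^{−s})‖ ≤ (3/2) p^{−η}` on `Re s > η > 1`). [folklore] -/
private theorem apLogL_differentiableOn_euler {q : ℕ} (χ : DirichletCharacter ℂ q) :
    DifferentiableOn ℂ
      (fun s : ℂ ↦ ∑' p : Nat.Primes, -log (1 - χ ((p : ℕ) : ZMod q) * ((p : ℕ) : ℂ) ^ (-s)))
      {s : ℂ | 1 < s.re} := by
  -- adapted from `Nicolas.differentiableOn_primeZetaLog` (Literature/NumberTheory/LFunctions/PrimeLogSeries.lean)
  intro w hw
  simp only [Set.mem_setOf_eq] at hw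
  obtain ⟨η, hη1, hηw⟩ : ∃ η : ℝ, 1 < η ∧ η < w.re := exists_between hw
  have hU : IsOpen {z : ℂ | η < z.re} := isOpen_lt continuous_const continuous_re
  suffices hd : DifferentiableOn ℂ
      (fun s : ℂ ↦ ∑' p : Nat.Primes, -log (1 - χ ((p : ℕ) : ZMod q) * ((p : ℕ) : ℂ) ^ (-s)))
      {z : ℂ | η < z.re} from
    (hd.differentiableAt (hU.mem_nhds hηw)).differentiableWithinAt
  refine differentiableOn_tsum_of_summable_norm (u := fun p : Nat.Primes ↦
    3 / 2 * ((p : ℕ) : ℝ) ^ (-η)) ((Nicolas.summable_primes_rpow_neg hη1).mul_left _) ?_ hU ?_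
  · intro p z hz
    have hz : η < z.re := hz
    obtain ⟨-, h2⟩ := norm_primes_cpow_neg_le_of_le_re (p := p) hη1 hz.le
    have h1 := apLogL_norm_term_le χ p hz.le
    refine ((((Nicolas.differentiable_primes_cpow_neg p z).const_mul _).const_sub 1).clog
      ?_).neg.differentiableWithinAt
    rw [sub_eq_add_neg]
    exact mem_slitPlane_of_norm_lt_one (by rw [norm_neg]; linarith)
  · intro p z hz
    have hz : η < z.re := hz
    obtain ⟨-, h2⟩ := norm_primes_cpow_neg_le_of_le_re (p := p) hη1 hz.le
    have h1 := apLogL_norm_term_le χ p hz.le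
    rw [norm_neg, sub_eq_add_neg]
    calc ‖log (1 + -(χ ((p : ℕ) : ZMod q) * ((p : ℕ) : ℂ) ^ (-z)))‖
        ≤ 3 / 2 * ‖-(χ ((p : ℕ) : ZMod q) * ((p : ℕ) : ℂ) ^ (-z))‖ :=
          norm_log_one_add_half_le_self (by rw [norm_neg]; linarith)
      _ ≤ 3 / 2 * ((p : ℕ) : ℝ) ^ (-η) := by rw [norm_neg]; linarith

/-- **`‖∑_p −Log(1 − χ(p)p^{−s})‖ ≤ log(σ/(σ − 1))`** for `σ = Re s > 1`: termwise
`‖Log(1 − χ(p)p^{−s})‖ ≤ −log(1 − p^{−σ})`, and `∑_p −log(1 − p^{−σ}) = log ζ(σ) ≤ log(σ/(σ − 1))`.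
[cite: MontgomeryVaughan2007, proof of Theorem 6.7] -/
private theorem apLogL_norm_euler_le {q : ℕ} (χ : DirichletCharacter ℂ q) {s : ℂ} (hs : 1 < s.re) :
    ‖∑' p : Nat.Primes, -log (1 - χ ((p : ℕ) : ZMod q) * ((p : ℕ) : ℂ) ^ (-s))‖ ≤
      Real.log (s.re / (s.re - 1)) := by
  -- adapted from `SatheSelberg.norm_eulerLogZeta_le` (LogZetaClassicalRegionBounds.lean)
  set σ : ℝ := s.re with hσdef
  have hσ : 1 < σ := hs
  have hσ' : 1 < (σ : ℂ).re := by simpa using hσ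
  have hsumC : Summable fun p : Nat.Primes ↦
      -log (1 - χ ((p : ℕ) : ZMod q) * ((p : ℕ) : ℂ) ^ (-s)) :=
    DirichletCharacter.summable_neg_log_one_sub_mul_prime_cpow χ hs
  have hsumσ := Nicolas.summable_primeZetaLog (w := (σ : ℂ)) hσ'
  have e : (fun p : Nat.Primes ↦ -Complex.log (1 - ((p : ℕ) : ℂ) ^ (-(σ : ℂ)))) =
      fun p : Nat.Primes ↦ ((-Real.log (1 - ((p : ℕ) : ℝ) ^ (-σ)) : ℝ) : ℂ) := by
    funext p; exact SatheSelberg.neg_log_one_sub_primes_cpow_ofReal p (by linarith)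
  have hsumR : Summable fun p : Nat.Primes ↦ -Real.log (1 - ((p : ℕ) : ℝ) ^ (-σ)) := by
    rw [e, Complex.summable_ofReal] at hsumσ
    exact hsumσ
  -- the real series is `log ζ(σ) ≤ log(σ/(σ − 1))`
  have hnorm := MontgomeryVaughan2001.norm_riemannZeta_eq_exp_re hσ'
  rw [Nicolas.primeZetaLog_ofReal hσ, ofReal_re] at hnorm
  have hζpos : 0 < ‖riemannZeta (σ : ℂ)‖ := by rw [hnorm]; exact Real.exp_pos _
  have hS : ∑' p : Nat.Primes, -Real.log (1 - ((p : ℕ) : ℝ) ^ (-σ)) =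
      Real.log ‖riemannZeta (σ : ℂ)‖ := by rw [hnorm, Real.log_exp]
  have hζ : Real.log ‖riemannZeta (σ : ℂ)‖ ≤ Real.log (σ / (σ - 1)) :=
    Real.log_le_log hζpos (MontgomeryVaughan2001.norm_zeta_real_le hσ)
  -- termwise comparison (`|χ(p)| ≤ 1`)
  have hterm : ∀ p : Nat.Primes, ‖-log (1 - χ ((p : ℕ) : ZMod q) * ((p : ℕ) : ℂ) ^ (-s))‖ ≤
      -Real.log (1 - ((p : ℕ) : ℝ) ^ (-σ)) := by
    intro p
    have hw : ‖χ ((p : ℕ) : ZMod q) * ((p : ℕ) : ℂ) ^ (-s)‖ ≤ ((p : ℕ) : ℝ) ^ (-σ) :=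
      apLogL_norm_term_le χ p le_rfl
    have hlt : ((p : ℕ) : ℝ) ^ (-σ) < 1 :=
      Real.rpow_lt_one_of_one_lt_of_neg (by exact_mod_cast p.2.one_lt) (by linarith)
    rw [norm_neg]
    calc ‖log (1 - χ ((p : ℕ) : ZMod q) * ((p : ℕ) : ℂ) ^ (-s))‖
        ≤ -Real.log (1 - ‖χ ((p : ℕ) : ZMod q) * ((p : ℕ) : ℂ) ^ (-s)‖) :=
          SatheSelberg.norm_log_one_sub_le (hw.trans_lt hlt)
      _ ≤ -Real.log (1 - ((p : ℕ) : ℝ) ^ (-σ)) :=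
          neg_le_neg (Real.log_le_log (by linarith) (by linarith))
  calc ‖∑' p : Nat.Primes, -log (1 - χ ((p : ℕ) : ZMod q) * ((p : ℕ) : ℂ) ^ (-s))‖
      ≤ ∑' p : Nat.Primes, ‖-log (1 - χ ((p : ℕ) : ZMod q) * ((p : ℕ) : ℂ) ^ (-s))‖ :=
        norm_tsum_le_tsum_norm hsumC.norm
    _ ≤ ∑' p : Nat.Primes, -Real.log (1 - ((p : ℕ) : ℝ) ^ (-σ)) :=
        hsumC.norm.tsum_le_tsum hterm hsumR
    _ = Real.log ‖riemannZeta (σ : ℂ)‖ := hS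
    _ ≤ Real.log (σ / (σ - 1)) := hζ

/-! ### The stub -/

/-- **Stub C `stub_apLogL`** (class `linₐ` of the crux `SystemZeroRepulsion`, line
`smooth-rough-lattice-acquisition`, skeleton v3): **the branch of `log L(s, χ)` on a classical region.**
For `χ ≠ χ₀` mod `q` there are `c > 0`, `C ≥ 0` (depending on `q`, `χ`) and `ℓ` holomorphic on
`zfr c = {σ > 1 − c/log(|t| + 4)}` with `‖ℓ(s)‖ ≤ log log(|t| + 4) + C` there and
`ℓ(s) = Σ_p −Log(1 − χ(p)p^{−s})` for `σ > 1` (so `exp ℓ = L(·, χ)`).  Proof in the module docstring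
(MV Theorem 11.4 + the continuous-logarithm machinery of `LogZetaClassicalRegion.lean` + the proof of
MV Theorem 6.7); `C = log 2 + A(1 + c)` with `A` the constant of `‖L'/L‖ ≤ A log(|t| + 4)` on `zfr c`.
[cite: MontgomeryVaughan2007, Theorem 11.4 and Theorem 6.7] -/
theorem stub_apLogL :
    ∀ (q : ℕ) [NeZero q] (χ : DirichletCharacter ℂ q), χ ≠ 1 → ∃ c : ℝ, 0 < c ∧ ∃ C : ℝ, 0 ≤ C ∧ ∃ ℓ : ℂ → ℂ,
      DifferentiableOn ℂ ℓ (Literature.NumberTheory.LFunctions.ClassicalPsiData.zfr c) ∧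
      (∀ s ∈ Literature.NumberTheory.LFunctions.ClassicalPsiData.zfr c, ‖ℓ s‖ ≤ Real.log (Real.log (|s.im| + 4)) + C) ∧
      (∀ s : ℂ, 1 < s.re →
        ℓ s = ∑' p : Nat.Primes, -Complex.log (1 - χ ((p : ℕ) : ZMod q) * ((p : ℕ) : ℂ) ^ (-s))) := by
  intro q _ χ hχ
  obtain ⟨c, hc, A, hA, hzf⟩ := apLogL_logDeriv_bound q χ hχ
  -- the Euler logarithm `E` and `exp E = L(·, χ)` on `σ > 1`
  set E : ℂ → ℂ := fun s ↦
    ∑' p : Nat.Primes, -log (1 - χ ((p : ℕ) : ZMod q) * ((p : ℕ) : ℂ) ^ (-s)) with hE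
  have hEexp : ∀ s : ℂ, 1 < s.re → exp (E s) = χ.LFunction s := fun s hs ↦ by
    rw [DirichletCharacter.LFunction_eq_LSeries χ hs]
    exact DirichletCharacter.LSeries_eulerProduct_exp_log χ hs
  -- the region
  set U : Set ℂ := ClassicalPsiData.zfr c with hU
  have hUo : IsOpen U := ClassicalPsiData.isOpen_zfr c
  have h2U : (2 : ℂ) ∈ U := ClassicalPsiData.mem_zfr_of_one_le_re hc (by norm_num)
  have hsub : {s : ℂ | 1 < s.re} ⊆ U := fun s hs ↦
    ClassicalPsiData.mem_zfr_of_one_le_re hc (le_of_lt hs)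
  have hL0 : ∀ s ∈ U, χ.LFunction s ≠ 0 := fun s hs ↦ (hzf s hs).1
  -- a continuous logarithm of `L(·, χ)` on `U`, normalised at `2`
  obtain ⟨f, hfc, hfe⟩ := Complex.exists_continuousOn_eqOn_exp_comp (apLogL_isSimplyConnected hc)
    hUo (DirichletCharacter.differentiable_LFunction hχ).continuous.continuousOn (by
      rintro ⟨s, hs, h0⟩
      exact hL0 s hs h0)
  set ℓ : ℂ → ℂ := fun s ↦ f s - f 2 + E 2 with hℓ
  have hℓc : ContinuousOn ℓ U := (hfc.sub continuousOn_const).add continuousOn_const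
  have hℓe : ∀ s ∈ U, exp (ℓ s) = χ.LFunction s := by
    intro s hs
    have e1 : exp (f s) = χ.LFunction s := hfe hs
    have e2 : exp (f 2) = χ.LFunction 2 := hfe h2U
    have e3 : exp (E 2) = χ.LFunction 2 := hEexp 2 (by norm_num)
    simp only [hℓ]
    rw [exp_add, exp_sub, e1, e2, e3, div_mul_cancel₀ _ (hL0 2 h2U)]
  have hℓd : DifferentiableOn ℂ ℓ U :=
    differentiableOn_of_exp_eq hUo (DirichletCharacter.differentiable_LFunction hχ).differentiableOn
      hℓc hℓe
  -- identification with `E` on `σ > 1`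
  have hℓE : EqOn ℓ E {s : ℂ | 1 < s.re} := by
    refine eqOn_of_exp_eq_exp (convex_halfSpace_re_gt 1).isPreconnected (hℓc.mono hsub)
      (apLogL_differentiableOn_euler χ).continuousOn (fun s hs ↦ ?_)
      (show (2 : ℂ) ∈ {s : ℂ | 1 < s.re} by simp) ?_
    · rw [hℓe s (hsub hs), hEexp s hs]
    · simp [hℓ]
  -- `ℓ' = L'/L` on `U`
  have hderiv : ∀ s ∈ U, HasDerivAt ℓ (deriv χ.LFunction s / χ.LFunction s) s := by
    -- adapted from `hasDerivAt_logZeta₁` (LogZetaClassicalRegion.lean)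
    intro s hs
    have hL := (hℓd.differentiableAt (hUo.mem_nhds hs)).hasDerivAt
    have heq : (fun z ↦ exp (ℓ z)) =ᶠ[𝓝 s] χ.LFunction :=
      eventuallyEq_of_mem (hUo.mem_nhds hs) fun z hz ↦ hℓe z hz
    have h1 : HasDerivAt (fun z ↦ exp (ℓ z)) (exp (ℓ s) * deriv ℓ s) s := hL.cexp
    have h2 : deriv χ.LFunction s = exp (ℓ s) * deriv ℓ s := by
      rw [← heq.deriv_eq]; exact h1.deriv
    rw [h2, hℓe s hs, mul_div_cancel_left₀ _ (hL0 s hs)]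
    exact hL
  refine ⟨c, hc, Real.log 2 + A * (1 + c), by positivity, ℓ, hℓd, fun s hs ↦ ?_, fun s hs ↦ hℓE hs⟩
  -- the bound `‖ℓ s‖ ≤ log log(|t| + 4) + C`
  set t : ℝ := s.im with ht
  set ℒ : ℝ := Real.log (|t| + 4) with hℒdef
  have hℒ1 : 1 ≤ ℒ := ClassicalZFRData.one_le_log_tau t
  have hℒ0 : 0 < ℒ := by linarith
  set σ₁ : ℝ := 1 + 1 / ℒ with hσ₁def
  have hσ₁ : 1 < σ₁ := by
    have : 0 < 1 / ℒ := by positivity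
    simp only [hσ₁def]; linarith
  -- to the right of `σ₁`: the Euler logarithm
  have hright : ∀ w : ℂ, w.im = t → σ₁ ≤ w.re → ‖ℓ w‖ ≤ Real.log ℒ + Real.log 2 := by
    intro w hwim hw
    have hw1 : 1 < w.re := lt_of_lt_of_le hσ₁ hw
    rw [hℓE hw1]
    calc ‖E w‖ ≤ Real.log (w.re / (w.re - 1)) := apLogL_norm_euler_le χ hw1
      _ ≤ Real.log (σ₁ / (σ₁ - 1)) := SatheSelberg.log_div_sub_one_anti hσ₁ hw
      _ = Real.log (ℒ + 1) := SatheSelberg.log_div_sub_one_eq hℒ0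
      _ ≤ Real.log (2 * ℒ) := Real.log_le_log (by linarith) (by linarith)
      _ = Real.log ℒ + Real.log 2 := by rw [Real.log_mul (by norm_num) hℒ0.ne', add_comm]
  have hAc : 0 ≤ A * (1 + c) := by positivity
  by_cases hcase : σ₁ ≤ s.re
  · calc ‖ℓ s‖ ≤ Real.log ℒ + Real.log 2 := hright s rfl hcase
      _ ≤ Real.log ℒ + (Real.log 2 + A * (1 + c)) := by linarith
  push Not at hcase
  -- to the left: integrate `ℓ' = L'/L ≪ ℒ` along `[σ, σ₁] + it` (mean value inequality)
  set σ : ℝ := s.re with hσdef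
  have hσU : 1 - c / ℒ < σ := hs
  set g : ℝ → ℂ := fun u ↦ ℓ ((u : ℂ) + t * I) with hgdef
  have hmem : ∀ u : ℝ, σ ≤ u → ((u : ℂ) + t * I) ∈ U := by
    intro u hu
    show 1 - c / Real.log (|((u : ℂ) + t * I).im| + 4) < ((u : ℂ) + t * I).re
    simpa using lt_of_lt_of_le hσU hu
  have hgd : ∀ u : ℝ, σ ≤ u → HasDerivAt g
      (deriv χ.LFunction ((u : ℂ) + t * I) / χ.LFunction ((u : ℂ) + t * I)) u := by
    intro u hu
    have h1 := hderiv _ (hmem u hu)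
    have h2 : HasDerivAt (fun w : ℂ ↦ w + t * I) 1 (u : ℂ) := (hasDerivAt_id _).add_const _
    have h3 := h1.comp (u : ℂ) h2
    rw [mul_one] at h3
    exact h3.comp_ofReal
  have hbound : ∀ u : ℝ, σ ≤ u →
      ‖deriv χ.LFunction ((u : ℂ) + t * I) / χ.LFunction ((u : ℂ) + t * I)‖ ≤ A * ℒ := by
    intro u hu
    have h := (hzf _ (hmem u hu)).2
    simpa using h
  have hMV : ‖g σ₁ - g σ‖ ≤ A * ℒ * (σ₁ - σ) := by
    have h := norm_image_sub_le_of_norm_deriv_le_segment' (f := g)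
      (f' := fun u ↦ deriv χ.LFunction ((u : ℂ) + t * I) / χ.LFunction ((u : ℂ) + t * I))
      (a := σ) (b := σ₁) (C := A * ℒ)
      (fun u hu ↦ (hgd u hu.1).hasDerivWithinAt) (fun u hu ↦ hbound u hu.1)
    exact h σ₁ ⟨hcase.le, le_rfl⟩
  have hgσ₁ : ‖g σ₁‖ ≤ Real.log ℒ + Real.log 2 := by
    have h := hright ((σ₁ : ℂ) + t * I) (by simp) (by simp)
    simpa [hgdef] using h
  have hgσ : g σ = ℓ s := by
    have : (σ : ℂ) + t * I = s := by
      apply Complex.ext <;> simp [hσdef, ht]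
    simp only [hgdef, this]
  have hwidth : σ₁ - σ ≤ (1 + c) / ℒ := by
    rw [add_div, hσ₁def]
    linarith
  have hprod : A * ℒ * (σ₁ - σ) ≤ A * (1 + c) := by
    calc A * ℒ * (σ₁ - σ) ≤ A * ℒ * ((1 + c) / ℒ) :=
          mul_le_mul_of_nonneg_left hwidth (by positivity)
      _ = A * (1 + c) := by field_simp
  rw [← hgσ]
  calc ‖g σ‖ = ‖g σ₁ - (g σ₁ - g σ)‖ := by rw [sub_sub_cancel]
    _ ≤ ‖g σ₁‖ + ‖g σ₁ - g σ‖ := norm_sub_le _ _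
    _ ≤ (Real.log ℒ + Real.log 2) + A * (1 + c) := add_le_add hgσ₁ (hMV.trans hprod)
    _ = Real.log ℒ + (Real.log 2 + A * (1 + c)) := by ring

end Summit.Parity.BatemanHorn.Cruxes.SystemZeroRepulsion.NearFar

end
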